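import Literature.AlgebraicGeometry.HodgeTheory.AlgebraicMonodromyMumfordTate
import HarnessLib

/-!
# Zariski closures of subgroups of `GL(V)` on `K`-points: descent along a field extension and
# reduction to normal finite-index subgroups (Borel, *Linear algebraic groups*, AG §§11–14, I.1.2, I.2.1;
# CMSP Lemma–Definition 15.3.7)

Family `hodge`, layer `Literature/AlgebraicGeometry/HodgeTheory`. THEOREMS only (no definition of
mathematical content beyond the bookkeeping homomorphism `glBaseChangeHom`, no named fact). Companion of
`AlgebraicMonodromyMumfordTate` (`glZariskiClosure`, `glIdentityComponent`), written by the prover seat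
`hodge-nonav-prover-Ax` (cell `hodge-nonav`) for the crux K1 `VeryGeneralDeckCommutatorsInHg` of the route
`Summits/HodgeConjecture/HodgeConjecture/Theses/CyclicUnitaryPowers.lean` (planner memo STUB-PLAN-B2-g19
§1 (E7) "descent of vanishing ideals … the bridge from any `ℚ̄`-argument back to the tree's `ℚ`-points
closure" and §4 AGL6 "descent and base change of the tree's `glZariskiClosure` from `ℚ`-points to
`ℚ̄`-points"; the identity-component form `glIdentityComponent Γ` is the target of the André exit
`Theorems/CyclicUnitaryPowersAndreExit`). Every density argument for the monodromy group of the cyclic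
family runs over `ℝ` or `ℂ` (Carlson–Toledo §7, typed as `carlsonToledo1999_unitaryReflection_zariskiDense`,
concludes on REAL points), while the crux is stated on `ℚ`-points; this file supplies the two formal
bridges that do not depend on any structure theory of algebraic groups.

## What is proved (any fields `K ⊆ L`, `V` finite-dimensional over `K`)

* `glBaseChangeHom K L V : GL_K(V) →* GL_L(L ⊗_K V)` — base change of automorphisms (Mathlib's
  `LinearEquiv.baseChange`, packaged as a group homomorphism).
* **`mem_glZariskiClosure_of_baseChange`** (DESCENT, the easy and only needed direction): if the base
  change `g_L` of `g ∈ GL_K(V)` lies in the `L`-Zariski closure of the base change `Δ_L` of a subgroup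
  `Δ ≤ GL_K(V)`, then `g` lies in the `K`-Zariski closure of `Δ` — a `K`-polynomial in the matrix entries
  vanishing on `Δ` is an `L`-polynomial vanishing on `Δ_L` (Borel AG 14.1–14.2: for a `K`-structure,
  `K`-polynomials extend to `L`-polynomials; the matrix of `g_L` in the base-changed basis is the matrix of
  `g`, `LinearMap.toMatrix_baseChange`). Consequence `mem_glIdentityComponent_of_baseChange`: the same for
  the identity components, finite-index subgroups of `Δ` mapping to finite-index subgroups of `Δ_L` with
  `Δ'_L ≤ Δ_L`.
* **`mem_glIdentityComponent_of_forall_normal`**: to prove `g ∈ glIdentityComponent Γ` (`= ⋂ Γ'^Zar` over the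
  finite-index `Γ' ≤ Γ`) it suffices to treat the finite-index subgroups `Γ'` that are NORMAL in `Γ` (pass
  to the normal core, which has finite index — Mathlib `Subgroup.normalCore`,
  `Subgroup.finiteIndex_normalCore` — and use monotonicity of the closure); CMSP, proof of 15.3.9:
  "replacing `Γ` by `Γ ∩ Mon(𝒫)`, a group of finite index".
* **`conj_mem_glZariskiClosure`**: the closure of `Δ` is stable under conjugation by any `γ` normalising `Δ`
  (conjugation by a fixed automorphism is a polynomial substitution in the matrix entries — the tree's
  `eval_bind₁_basisChange` pattern; Borel I.2.1 (c)); hence `conj_mem_glZariskiClosure_of_normal`: for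
  `Γ' ⊴ Γ` of finite index and `γ ∈ Γ`, `γ (Γ')^Zar γ⁻¹ = (Γ')^Zar` elementwise.

## References
* [Borel1991] A. Borel, *Linear Algebraic Groups*, 2nd ed., GTM 126 (1991): AG §11–§14 (`k`-structures,
  extension of the base field), I.1.2 (identity component), I.2.1 (closures of subgroups; conjugation).
* [CarlsonMullerStachPeters2017] J. Carlson, S. Müller-Stach, C. Peters, *Period Mappings and Period
  Domains*, 2nd ed. (2017), Lemma–Definition 15.3.7 and proof of Prop. 15.3.9.
-/

noncomputable section

open Literature.AlgebraicGeometry.Motives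
open scoped TensorProduct

namespace Literature.AlgebraicGeometry.HodgeTheory

/-! ### §1 Base change of automorphisms and descent of Zariski-closure membership -/

section BaseChange

universe u v w

variable (K : Type u) [Field K] (L : Type w) [Field L] [Algebra K L]
  (V : Type v) [AddCommGroup V] [Module K V]

/-- **Base change of automorphisms** `GL_K(V) →* GL_L(L ⊗_K V)`, `g ↦ 1 ⊗ g` (Mathlib's
`LinearEquiv.baseChange`, a group homomorphism by `LinearEquiv.baseChange_one/_mul`).
[cite: Borel1991, AG §14.1] -/
def glBaseChangeHom : (V ≃ₗ[K] V) →* (L ⊗[K] V ≃ₗ[L] L ⊗[K] V) where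
  toFun g := LinearEquiv.baseChange K L V V g
  map_one' := LinearEquiv.baseChange_one (R := K) (A := L) (M := V)
  map_mul' g h := LinearEquiv.baseChange_mul (R := K) (A := L) (M := V) g h

/-- Unfolding of `glBaseChangeHom`. [cite: Borel1991, AG §14.1] -/
theorem glBaseChangeHom_apply (g : V ≃ₗ[K] V) : glBaseChangeHom K L V g = LinearEquiv.baseChange K L V V g :=
  rfl

/-- The underlying `L`-linear map of the base change of `g` is the base change of the underlying map of
`g`. [cite: Borel1991, AG §14.1] -/
theorem coe_glBaseChangeHom (g : V ≃ₗ[K] V) :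
    ((glBaseChangeHom K L V g : L ⊗[K] V ≃ₗ[L] L ⊗[K] V) : L ⊗[K] V →ₗ[L] L ⊗[K] V) =
      (g : V →ₗ[K] V).baseChange L :=
  rfl

variable {K L V}

/-- Evaluating the `L`-image of a `K`-polynomial at the `L`-images of a `K`-point gives the `L`-image of the
`K`-evaluation. [folklore] -/
private theorem eval_map_algebraMap {σ : Type*} (x : σ → K) (P : MvPolynomial σ K) :
    MvPolynomial.eval (fun i => algebraMap K L (x i)) (MvPolynomial.map (algebraMap K L) P) =
      algebraMap K L (MvPolynomial.eval x P) := by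
  rw [MvPolynomial.eval_map]
  change MvPolynomial.eval₂ (algebraMap K L) ((algebraMap K L) ∘ x) P =
    algebraMap K L (MvPolynomial.eval₂ (RingHom.id K) x P)
  rw [MvPolynomial.eval₂_comp_left (algebraMap K L) (RingHom.id K) x P, RingHom.comp_id]

variable [Module.Finite K V]

/-- **Descent of Zariski-closure membership along a field extension** (the easy direction of Borel AG 14.2,
all that the consumers need): if `g_L = 1 ⊗ g` lies in the `L`-Zariski closure of `Δ_L = {1 ⊗ δ : δ ∈ Δ}`,
then `g` lies in the `K`-Zariski closure of `Δ`. Proof: a `K`-polynomial `P` in the matrix entries (for a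
`K`-basis `b` of `V`) vanishing on `Δ` gives the `L`-polynomial `P ⊗ 1` in the entries for the basis
`1 ⊗ b` of `L ⊗ V`, which vanishes on `Δ_L` (the matrix of `1 ⊗ δ` is the matrix of `δ`,
`LinearMap.toMatrix_baseChange`), hence at `g_L`, i.e. `P(g) = 0` in `L`, hence in `K`.
[cite: Borel1991, AG §14.1–14.2] -/
theorem mem_glZariskiClosure_of_baseChange {Δ : Subgroup (V ≃ₗ[K] V)} {g : V ≃ₗ[K] V}
    (h : glBaseChangeHom K L V g ∈ glZariskiClosure (Δ.map (glBaseChangeHom K L V))) :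
    g ∈ glZariskiClosure Δ := by
  classical
  let b := Module.Free.chooseBasis K V
  let bL := Algebra.TensorProduct.basis L b
  rw [mem_glZariskiClosure_iff, ← zariskiClosureEnd_basis_indep b, mem_zariskiClosureEndOfBasis_iff]
  rw [mem_glZariskiClosure_iff, ← zariskiClosureEnd_basis_indep bL, mem_zariskiClosureEndOfBasis_iff] at h
  intro P hP
  have key := h (MvPolynomial.map (algebraMap K L) P) ?_
  · -- the matrix of `g_L` in `1 ⊗ b` is the image of the matrix of `g`
    have hmat : (fun ij : Module.Free.ChooseBasisIndex K V × Module.Free.ChooseBasisIndex K V =>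
        LinearMap.toMatrix bL bL ((glBaseChangeHom K L V g : L ⊗[K] V ≃ₗ[L] L ⊗[K] V) :
          L ⊗[K] V →ₗ[L] L ⊗[K] V) ij.1 ij.2) =
        fun ij => algebraMap K L (LinearMap.toMatrix b b (g : V →ₗ[K] V) ij.1 ij.2) := by
      funext ij
      rw [coe_glBaseChangeHom, LinearMap.toMatrix_baseChange, Matrix.map_apply]
    rw [hmat, eval_map_algebraMap] at key
    exact (algebraMap K L).injective (by rw [key, map_zero])
  · -- `P ⊗ 1` vanishes on `Δ_L`
    rintro _ ⟨x, hx, rfl⟩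
    obtain ⟨δ, hδ, rfl⟩ := Subgroup.mem_map.1 hx
    have hmat : (fun ij : Module.Free.ChooseBasisIndex K V × Module.Free.ChooseBasisIndex K V =>
        LinearMap.toMatrix bL bL ((glBaseChangeHom K L V δ : L ⊗[K] V ≃ₗ[L] L ⊗[K] V) :
          L ⊗[K] V →ₗ[L] L ⊗[K] V) ij.1 ij.2) =
        fun ij => algebraMap K L (LinearMap.toMatrix b b (δ : V →ₗ[K] V) ij.1 ij.2) := by
      funext ij
      rw [coe_glBaseChangeHom, LinearMap.toMatrix_baseChange, Matrix.map_apply]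
    rw [hmat, eval_map_algebraMap, hP _ ⟨δ, hδ, rfl⟩, map_zero]

omit [Module.Finite K V] in
/-- A finite-index subgroup of `Δ` maps to a finite-index subgroup of `Δ_L` (the base-change homomorphism
restricted to `Δ` is surjective onto `Δ_L`; the index bookkeeping behind "the identity component has
finite index", Borel I.1.2). [cite: Borel1991, AG §14.1 and I.1.2] -/
theorem finiteIndex_map_glBaseChangeHom {Δ Δ' : Subgroup (V ≃ₗ[K] V)}
    (hfi : (Δ'.subgroupOf Δ).FiniteIndex) :
    ((Δ'.map (glBaseChangeHom K L V)).subgroupOf (Δ.map (glBaseChangeHom K L V))).FiniteIndex := by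
  -- the homomorphism `Δ → Δ_L` induced by base change is surjective, and pulls `Δ'_L ∩ Δ_L` back to a
  -- subgroup containing `Δ'`
  let φ : Δ →* (Δ.map (glBaseChangeHom K L V)) :=
    ((glBaseChangeHom K L V).restrict Δ).codRestrict _ fun x => Subgroup.mem_map_of_mem _ x.2
  have hφ : Function.Surjective φ := by
    rintro ⟨_, hy⟩
    obtain ⟨δ, hδ, rfl⟩ := Subgroup.mem_map.1 hy
    exact ⟨⟨δ, hδ⟩, rfl⟩
  have hcomap : (Δ'.subgroupOf Δ) ≤
      ((Δ'.map (glBaseChangeHom K L V)).subgroupOf (Δ.map (glBaseChangeHom K L V))).comap φ := by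
    intro x hx
    rw [Subgroup.mem_comap, Subgroup.mem_subgroupOf]
    exact Subgroup.mem_map_of_mem _ (Subgroup.mem_subgroupOf.1 hx)
  haveI : ((((Δ'.map (glBaseChangeHom K L V)).subgroupOf (Δ.map (glBaseChangeHom K L V))).comap φ)).FiniteIndex :=
    Subgroup.finiteIndex_of_le hcomap
  refine ⟨?_⟩
  have hidx := Subgroup.index_comap_of_surjective
    (H := (Δ'.map (glBaseChangeHom K L V)).subgroupOf (Δ.map (glBaseChangeHom K L V))) hφ
  rw [← hidx]
  exact this.index_ne_zero

/-- **Descent for the identity component**: if `g_L` lies in `glIdentityComponent Δ_L` then `g` lies in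
`glIdentityComponent Δ` (every finite-index `Δ' ≤ Δ` has `Δ'_L ≤ Δ_L` of finite index, and
`mem_glZariskiClosure_of_baseChange`). [cite: Borel1991, AG §14.2 and I.1.2] -/
theorem mem_glIdentityComponent_of_baseChange {Δ : Subgroup (V ≃ₗ[K] V)} {g : V ≃ₗ[K] V}
    (h : glBaseChangeHom K L V g ∈ glIdentityComponent (Δ.map (glBaseChangeHom K L V))) :
    g ∈ glIdentityComponent Δ := by
  rw [mem_glIdentityComponent_iff] at h ⊢
  intro Δ' hle hfi
  exact mem_glZariskiClosure_of_baseChange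
    (h _ (Subgroup.map_mono hle) (finiteIndex_map_glBaseChangeHom hfi))

end BaseChange

/-! ### §2 Normal finite-index subgroups suffice; conjugation-stability of the closure -/

section Normal

universe u v

variable {K : Type u} [Field K] {V : Type v} [AddCommGroup V] [Module K V] [Module.Finite K V]

/-- **Normal finite-index subgroups suffice for the identity component**: if `g ∈ (Γ')^Zar` for every
finite-index subgroup `Γ' ≤ Γ` which is normal in `Γ`, then `g ∈ glIdentityComponent Γ` (a finite-index
`Γ'` contains its normal core, of finite index, and the closure is monotone). CMSP, proof of 15.3.9:
"replacing `Γ` by […] a group of finite index". [cite: CarlsonMullerStachPeters2017, Lemma–Definition 15.3.7 and proof of Proposition 15.3.9] -/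
theorem mem_glIdentityComponent_of_forall_normal {Γ : Subgroup (V ≃ₗ[K] V)} {g : V ≃ₗ[K] V}
    (h : ∀ Γ' : Subgroup (V ≃ₗ[K] V), Γ' ≤ Γ → (Γ'.subgroupOf Γ).FiniteIndex → (Γ'.subgroupOf Γ).Normal →
      g ∈ glZariskiClosure Γ') :
    g ∈ glIdentityComponent Γ := by
  rw [mem_glIdentityComponent_iff]
  intro Γ' hle hfi
  -- the normal core of `Γ' ∩ Γ` in `Γ`, pushed back into the ambient group
  let N : Subgroup Γ := (Γ'.subgroupOf Γ).normalCore
  let Γ'' : Subgroup (V ≃ₗ[K] V) := N.map Γ.subtype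
  have hΓ''le : Γ'' ≤ Γ' := by
    rintro _ ⟨x, hx, rfl⟩
    exact Subgroup.mem_subgroupOf.1 (Subgroup.normalCore_le _ hx)
  have hΓ''Γ : Γ'' ≤ Γ := by
    rintro _ ⟨x, _, rfl⟩
    exact x.2
  have hsub : Γ''.subgroupOf Γ = N := by
    ext x
    rw [Subgroup.mem_subgroupOf]
    constructor
    · rintro ⟨y, hy, hyx⟩
      have : y = x := Subtype.ext hyx
      exact this ▸ hy
    · intro hx
      exact ⟨x, hx, rfl⟩
  haveI hN : N.FiniteIndex := Subgroup.finiteIndex_normalCore _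
  have hfi'' : (Γ''.subgroupOf Γ).FiniteIndex := by rw [hsub]; exact hN
  have hnorm : (Γ''.subgroupOf Γ).Normal := by rw [hsub]; exact Subgroup.normalCore_normal _
  exact glZariskiClosure_mono hΓ''le (h Γ'' hΓ''Γ hfi'' hnorm)

variable {ι : Type*} [Fintype ι] [DecidableEq ι]

omit [DecidableEq ι] [Module.Finite K V] in
/-- Two-sided multiplication is a polynomial substitution (the tree's `eval_bind₁_basisChange` for arbitrary
matrices `A`, `C`): substituting the generic product `A · X · C` into `P` and evaluating at `X₀` is
evaluating `P` at `A X₀ C`. [folklore] -/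
private theorem eval_bind₁_mul_mul' (A C X₀ : Matrix ι ι K) (P : MvPolynomial (ι × ι) K) :
    MvPolynomial.eval (fun ij : ι × ι => X₀ ij.1 ij.2)
        (MvPolynomial.bind₁ (fun ij : ι × ι => ∑ l : ι, (∑ k : ι,
          MvPolynomial.C (A ij.1 k) * MvPolynomial.X (k, l)) * MvPolynomial.C (C l ij.2)) P) =
      MvPolynomial.eval (fun ij : ι × ι => (A * X₀ * C) ij.1 ij.2) P := by
  rw [MvPolynomial.eval, MvPolynomial.eval₂Hom_bind₁, ← MvPolynomial.eval, ← MvPolynomial.eval]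
  refine congrArg (fun c => MvPolynomial.eval c P) (funext fun ij => ?_)
  simp only [map_sum, map_mul, MvPolynomial.eval_C, MvPolynomial.eval_X, Matrix.mul_apply, Finset.sum_mul]

omit [Module.Finite K V] in
/-- Conjugation-stability in a basis: if `γ Δ γ⁻¹ ⊆ Δ` then `γ (Δ^Zar) γ⁻¹ ⊆ Δ^Zar`, computed in the basis
`b`. [cite: Borel1991, I.2.1] -/
private theorem conj_mem_zariskiClosureEndOfBasis (b : Module.Basis ι K V) {S : Set (Module.End K V)}
    {a c : Module.End K V} (hS : ∀ s ∈ S, a * s * c ∈ S) {x : Module.End K V}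
    (hx : x ∈ zariskiClosureEndOfBasis b S) : a * x * c ∈ zariskiClosureEndOfBasis b S := by
  intro P hP
  have key := hx (MvPolynomial.bind₁ (fun ij : ι × ι => ∑ l : ι, (∑ k : ι,
    MvPolynomial.C (LinearMap.toMatrix b b a ij.1 k) * MvPolynomial.X (k, l)) *
      MvPolynomial.C (LinearMap.toMatrix b b c l ij.2)) P) (fun s hs => by
      rw [eval_bind₁_mul_mul', ← LinearMap.toMatrix_mul, ← LinearMap.toMatrix_mul]
      exact hP _ (hS s hs))
  rwa [eval_bind₁_mul_mul', ← LinearMap.toMatrix_mul, ← LinearMap.toMatrix_mul] at key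

/-- **The Zariski closure of `Δ` is stable under conjugation by any `γ` normalising `Δ`**: if
`γ δ γ⁻¹ ∈ Δ` for all `δ ∈ Δ` and `x ∈ Δ^Zar(K)`, then `γ x γ⁻¹ ∈ Δ^Zar(K)` (conjugation by a fixed
automorphism is a polynomial substitution in the matrix entries). [cite: Borel1991, I.2.1] -/
theorem conj_mem_glZariskiClosure {Δ : Subgroup (V ≃ₗ[K] V)} {γ : V ≃ₗ[K] V}
    (hγ : ∀ δ ∈ Δ, γ * δ * γ⁻¹ ∈ Δ) {x : V ≃ₗ[K] V} (hx : x ∈ glZariskiClosure Δ) :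
    γ * x * γ⁻¹ ∈ glZariskiClosure Δ := by
  classical
  let b := Module.Free.chooseBasis K V
  rw [mem_glZariskiClosure_iff, ← zariskiClosureEnd_basis_indep b] at hx ⊢
  have h := conj_mem_zariskiClosureEndOfBasis b (a := (γ : Module.End K V)) (c := ((γ⁻¹ : V ≃ₗ[K] V) : Module.End K V))
    (S := (fun h : V ≃ₗ[K] V => (h : Module.End K V)) '' (Δ : Set (V ≃ₗ[K] V))) ?_ hx
  · simpa only [LinearEquiv.coe_toLinearMap_mul] using h
  · rintro _ ⟨δ, hδ, rfl⟩
    exact ⟨γ * δ * γ⁻¹, hγ δ hδ, by simp only [LinearEquiv.coe_toLinearMap_mul]⟩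

/-- For a subgroup `Γ' ≤ Γ` normal in `Γ` and `γ ∈ Γ`: `γ (Γ')^Zar γ⁻¹ ⊆ (Γ')^Zar` — the closures of the
normal finite-index subgroups of a monodromy group are normalised by the whole monodromy group.
[cite: Borel1991, I.2.1] [cite: CarlsonMullerStachPeters2017, proof of Proposition 15.3.9] -/
theorem conj_mem_glZariskiClosure_of_normal {Γ Γ' : Subgroup (V ≃ₗ[K] V)} (hle : Γ' ≤ Γ)
    (hN : (Γ'.subgroupOf Γ).Normal) {γ : V ≃ₗ[K] V} (hγ : γ ∈ Γ) {x : V ≃ₗ[K] V}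
    (hx : x ∈ glZariskiClosure Γ') : γ * x * γ⁻¹ ∈ glZariskiClosure Γ' := by
  refine conj_mem_glZariskiClosure (fun δ hδ => ?_) hx
  have h := hN.conj_mem ⟨δ, hle hδ⟩ (Subgroup.mem_subgroupOf.2 hδ) ⟨γ, hγ⟩
  rw [Subgroup.mem_subgroupOf] at h
  exact h

end Normal

end Literature.AlgebraicGeometry.HodgeTheory

end
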